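import Literature.NumberTheory.IwasawaTheory.ClassicalLambdaInvariant
import HarnessLib

/-!
# Ferrero 1980 / Kida 1979: the `λ`-invariant of the cyclotomic `ℤ₂`-extension of an imaginary quadratic field,
# `λ₂(ℚ(√−d)) = −1 + Σ_{p ∣ d, p odd} 2^{ord₂(p²−1)−3}` (named fact, statement only)

Topic `NumberTheory/IwasawaTheory` (namespace = path).  STATEMENT-ONLY file: ONE named fact (`def … : Prop`, the printed statement, no proof claimed; D-0014),
written by the prover seat `bsd-line-att-p3` g29 (cell `bsd-f1-sign2`, route `AlignedTransportAtTwo`, crux C2 stmt-BirchSwinnertonDyer-22298: the parity bit of `λ₂` of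
the sextic carrier `ℚ(W[2])` is read on its resolvent `ℚ(√Δ_W)`; closes nothing; BSD is proved for no curve here).  The arithmetic of the sum (it is even iff
`d ≡ ±1 (mod 8)`) is PROVED in the sibling `FerreroKidaSumParity.lean`.

SOURCE (held, read 2026-08-30): J. Schettler, *An alternative approach to Kida and Ferrero's computations of Iwasawa λ-invariants*, J. Number Theory 138 (2014)
(arXiv:1211.1727), §1 Thm. 2, quoting [Ferr] = B. Ferrero, *The cyclotomic ℤ₂-extension of imaginary quadratic fields*, Amer. J. Math. 102 (1980) 447–459 and
[Kida2] = Y. Kida, *On cyclotomic ℤ₂-extensions of imaginary quadratic fields*, Tôhoku Math. J. 31 (1979) 91–96: «Bruce Ferrero and Yûji Kida independently calculated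
`λ₂(k)` for imaginary quadratic fields `k`. Their computations are explicit: THEOREM 2 (Ferrero, [Ferr]; Kida, [Kida2]). Let `d > 2` be a squarefree integer. Then
`λ₂(ℚ(√−d)) = −1 + Σ_{p ∣ d, p ≠ 2} 2^{ord₂(p²−1) − 3}` where the sum ranges over all odd primes `p` dividing `d`.»

References: [Schettler2014] Thm. 2; [Ferrero1980]; [Kida1979]; [Washington1997] §13.3 Thm. 13.13 (`λ` as the eventual slope of `e_n = ord₂ h(K_n)`).
-/

noncomputable section

open scoped NumberField
open NumberField

namespace Literature.NumberTheory.IwasawaTheory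

open Literature.NumberTheory.EllipticCurves

/-! ## §0 The named fact (PRINT): Ferrero 1980 / Kida 1979 -/

/-- **Ferrero 1980 / Kida 1979 — the `λ`-invariant of the cyclotomic `ℤ₂`-extension of an imaginary quadratic field.**  Printed (Schettler, J. Number Theory 138
(2014), Thm. 2, quoting [Ferr] = Ferrero, Amer. J. Math. 102 (1980) and [Kida2] = Kida, Tôhoku Math. J. 31 (1979), who «independently calculated `λ₂(k)` for imaginary
quadratic fields `k`. Their computations are explicit»): «Let `d > 2` be a squarefree integer. Then `λ₂(ℚ(√−d)) = −1 + Σ_{p ∣ d, p ≠ 2} 2^{ord₂(p²−1) − 3}` where the sum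
ranges over all odd primes `p` dividing `d`.»  Here (ibid. §1) `λ₂(k)` is the Iwasawa `λ`-invariant of the cyclotomic `ℤ₂`-extension of `k` in the growth formula
`|A_n| = 2^{λ·n + μ·2ⁿ + ν}` (`n ≫ 0`), and `μ₂(k) = 0` for these (abelian) fields by the Ferrero–Washington theorem (ibid. §1: «verified for
abelian number fields by Bruce Ferrero and Lawrence Washington … We make the assumption `μ_p(k) = 0` throughout the paper»).  TRANSCRIPTION in the tree's growth-form currency (`IwasawaTheory.ClassicalMuVanishes`,
`IwasawaTheory.classicalLambda`: under `μ = 0`, `e_n = λ n + ν` for `n ≫ 0`): for a number field `K` with `[K : ℚ] = 2` containing `δ` with `δ² = −d`, `d > 2` a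
squarefree natural number, and ANY cyclotomic `ℤ₂`-extension `κ` of `K` (all normalisations have the same layers): `ClassicalMuVanishes κ` and
`classicalLambda κ + 1 = Σ_{p ∈ primeFactors d, p ≠ 2} 2^{v₂(p² − 1) − 3}` (written additively to stay in `ℕ`; each summand is `≥ 1`).  A named fact; no `_holds`
(Iwasawa's Riemann–Hurwitz formula / the structure of `X = Gal(L_∞/K_∞)`; size L for the tree).
[cite: Schettler2014, Thm. 2 (p. 3)] [cite: Ferrero1980, main theorem (original; not held)] [cite: Kida1979, main theorem (original; not held)]-/
def ferreroKida_classicalLambda_two_imaginaryQuadratic : Prop :=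
  ∀ (K : Type) [Field K] [NumberField K] (d : ℕ), Squarefree d → 2 < d → Module.finrank ℚ K = 2 → (∃ δ : K, δ ^ 2 = -((d : ℕ) : K)) →
    ∀ κ : ZpExtension K 2, κ.IsCyclotomic →
      ClassicalMuVanishes κ ∧ classicalLambda κ + 1 = ∑ p ∈ d.primeFactors.erase 2, 2 ^ (padicValNat 2 (p ^ 2 - 1) - 3)


end Literature.NumberTheory.IwasawaTheory

end
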